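import Summits.CriticalPhenomena.PercolationContinuityZ3.Theorems.PercNearOneGluingNoHeavyLowerTailKernelTwoPlusTwo
import Summits.CriticalPhenomena.PercolationContinuityZ3.Theorems.PercNearOneGluingNoHeavyLowerTailKNGoodFormalCorner
import Summits.CriticalPhenomena.PercolationContinuityZ3.Theorems.PercNearOneGluingNoHeavyLowerTailKNGoodTwoPortArgmin
import HarnessLib

/-!
# The GOODNESS functional of a one-layer observer, pattern by pattern, and the formal×formal corner at goodness strength
# (`NoHeavyLowerTail` cell, stmt-CriticalPhenomena-4575; prover `prim-hp-2`, deletion–contraction line, gen 8)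

Support file (`--supports stmt-CriticalPhenomena-4575`).  No definitions, no named facts, no sorries.
Memo: `run/shared/lean/prim/prim-hp-2/MEMO-gen6-gc-formal-corner.md` §0–3 and the gen-8 notes (GC face of the `2+2` cell).

`o` is a one-layer observer with port set `P ⊆ A` (every other pair at `o`, and the loop, of weight `0`), `K := W` with `o` killed,
`π(B) = ∏_{p∈B} h_p ∏_{u∈P∖B} (1−h_u)` the law of the open-hair pattern, `K_B := K[s(o,t) ↦ 1, t ∈ B]` the forced star.
Kozma–Nitzan's goodness functional with explicit witness `j`,
`agood(W, o; j) := μ_W(o ↔ b) − μ_W(j ↔ b) + Σ_{W' ∩ A = ∅} μ_W(C(o) = W')·min_{a∈A} μ_W(a ↔ b off W')`, satisfies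

* `KNGoodTwoTwo.agood_oneLayer_ge` — `agood(W, o; j) ≥ Σ_{∅ ≠ B ⊆ P} π(B)·[μ_{K_B}(o ↔ b) − μ_{K_B}(j ↔ b)] + π(∅)·[min_a μ_K(a ↔ b) − μ_K(j ↔ b)]`
  (σ-law expansion of the two reliabilities, `StarPatternForcing`; the correction sum is bounded below by its `W' = {o}` term, which is
  `π(∅)·min_a μ_K(a ↔ b)` — Kozma–Nitzan's proof of Thm. 4).  The only difference with the (41)-margin of `OneLayerForcedExpansion` is the
  `B = ∅` term, which carries the goodness DEFICIT `min_a μ_K(a↔b) − μ_K(j↔b) ≤ 0` of the witness.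
* `KNGoodTwoTwo.gcffCorner` — the formal×formal corner of the `2+2` torus at goodness strength, in the forced-star coordinates of
  `UpsetExchange.ffCorner`: from the split rows of `r` (a minimiser of `μ_K(· ↔ b)` below `p₁` and `q₁`), `p₁` and `q₁`,
  `0 ≤ (1−u)(1−v)(μ_K(r↔b) − μ_K(j↔b)) + u(1−v)·G{p₁,p₂} + (1−u)v·G{q₁,q₂} + uv·G{q₂,q₁,p₁,p₂}`  (`KNGoodFormalCorner.twoFormalUnits_gc` + `forcedMargin_eq`).
-/

namespace Summit.CriticalPhenomena.PercolationContinuityZ3.Theorems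

open MeasureTheory Set ProbabilityTheory
open Literature.Probability.LatticeModels
open Literature.Probability.Percolation

noncomputable section
open Classical

namespace KNGoodTwoTwo

open UpsetExchange KNGoodAux KNGoodFormalCorner

variable {n : ℕ}

/-- Under a weighting in which `o` is isolated, avoiding `o` costs nothing: `μ_K(a ↔ b off o) = μ_K(a ↔ b)` for `a ≠ o`. [folklore] -/
theorem real_openConnIn_compl_singleton_of_isolated (K : Sym2 (Fin n) → unitInterval) (o a b : Fin n) (hao : a ≠ o)
    (hiso : ∀ u : Fin n, u ≠ o → K s(o, u) = 0) :
    (prodBernoulli K).real (openConnIn ({o}ᶜ : Set (Fin n)) a b) = (prodBernoulli K).real (openConn a b) := by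
  apply le_antisymm
  · exact measureReal_mono (fun ω hω => KNPreFKG.reachable_of_openConnIn hω) (measure_ne_top _ _)
  · have hsub : (openConn a b : Set (BondConfig (Fin n))) ⊆ openConnIn ({o}ᶜ : Set (Fin n)) a b ∪ openConn o a := by
      intro ω hω
      by_cases h : ω ∈ openConnIn ({o}ᶜ : Set (Fin n)) a b
      · exact Or.inl h
      · right
        by_contra hno
        apply h
        refine openConnIn_of_reachable_of_forall_mem hω fun y hy => ?_
        rw [mem_compl_singleton_iff]
        rintro rfl
        exact hno ((hy.symm : (openGraph ω).Reachable y a))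
    have h0 : (prodBernoulli K).real (openConn o a) = 0 := real_openConn_isolated_eq_zero K o hiso a hao
    calc (prodBernoulli K).real (openConn a b)
        ≤ (prodBernoulli K).real (openConnIn ({o}ᶜ : Set (Fin n)) a b ∪ openConn o a) :=
          measureReal_mono hsub (measure_ne_top _ _)
      _ ≤ (prodBernoulli K).real (openConnIn ({o}ᶜ : Set (Fin n)) a b) + (prodBernoulli K).real (openConn o a) :=
          measureReal_union_le _ _
      _ = (prodBernoulli K).real (openConnIn ({o}ᶜ : Set (Fin n)) a b) := by rw [h0, add_zero]

/-- **The goodness functional of a one-layer observer, pattern by pattern (lower bound).**  See the module docstring.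
[cite: KozmaNitzan2024, §3.2 Definition (p. 12), proof of Thm. 4 (pp. 13–14)] -/
theorem agood_oneLayer_ge (W : Sym2 (Fin n) → unitInterval) (A P : Finset (Fin n)) (hA : A.Nonempty) (o j b : Fin n)
    (hoA : o ∉ A) (hPA : P ⊆ A) (hbo : b ≠ o)
    (hiso : ∀ u : Fin n, u ≠ o → u ∉ P → W s(o, u) = 0) (hloop : W s(o, o) = 0)
    (K : Sym2 (Fin n) → unitInterval) (hK : K = fun e => if o ∈ e then 0 else W e) :
    ∑ B ∈ P.powerset, ((∏ p ∈ B, (W s(o, p) : ℝ)) * ∏ u ∈ P \ B, (1 - (W s(o, u) : ℝ))) *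
        (if B = ∅ then A.inf' hA (fun a => (prodBernoulli K).real (openConn a b)) - (prodBernoulli K).real (openConn j b)
          else (prodBernoulli (fun f : Sym2 (Fin n) => if f ∈ B.image (fun t => s(o, t)) then 1 else K f)).real (openConn o b) -
            (prodBernoulli (fun f : Sym2 (Fin n) => if f ∈ B.image (fun t => s(o, t)) then 1 else K f)).real (openConn j b)) ≤
      (prodBernoulli W).real (openConn o b) - (prodBernoulli W).real (openConn j b) +
        ∑ W' ∈ nullSets A, (prodBernoulli W).real (clusterIs o W') *
          A.inf' hA (fun a => (prodBernoulli W).real (openConnIn ((↑W' : Set (Fin n))ᶜ) a b)) := by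
  set μ := prodBernoulli W with hμ
  have hoP : o ∉ P := fun h => hoA (hPA h)
  have hisoK : ∀ u : Fin n, u ≠ o → K s(o, u) = 0 := fun u _ => by rw [hK]; simp
  obtain ⟨π, hπ⟩ : ∃ π : Finset (Fin n) → ℝ, ∀ B : Finset (Fin n), π B =
      (∏ p ∈ B, (W s(o, p) : ℝ)) * ∏ u ∈ P \ B, (1 - (W s(o, u) : ℝ)) := ⟨_, fun _ => rfl⟩
  -- star decompositions of the two reliabilities
  have hdec0 : μ.real (openConn o b) = ∑ B ∈ P.powerset, μ.real (openConn o b ∩ starEvent o ↑B) :=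
    KNPreFKG.real_eq_sum_inter_starEvent W P o hoP hiso (openConn o b)
  have hdec1 : μ.real (openConn j b) = ∑ B ∈ P.powerset, μ.real (openConn j b ∩ starEvent o ↑B) :=
    KNPreFKG.real_eq_sum_inter_starEvent W P o hoP hiso (openConn j b)
  have hforced : ∀ T : Finset (Fin n),
      (fun e : Sym2 (Fin n) => if o ∈ e then (if ∃ p ∈ T, e = s(o, p) then (1 : unitInterval) else 0) else W e) =
        fun f => if f ∈ T.image (fun t => s(o, t)) then 1 else K f := by
    intro T; rw [forcedStar_eq_memForm W o T, hK]
  have hπB : ∀ B ∈ P.powerset, μ.real (starEvent o (↑B : Set (Fin n))) = π B := by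
    intro B hB
    rw [hπ, real_starEvent_eq_prod_ports W o P B hoP (Finset.mem_powerset.1 hB) hiso]
  have hterm : ∀ (z : Fin n), ∀ B ∈ P.powerset, μ.real (openConn z b ∩ starEvent o ↑B) =
      π B * (prodBernoulli (fun f : Sym2 (Fin n) => if f ∈ B.image (fun t => s(o, t)) then 1 else K f)).real (openConn z b) := by
    intro z B hB
    have hoB : o ∉ B := fun h => hoP (Finset.mem_powerset.1 hB h)
    rw [hμ, real_inter_starEvent_eq_mul_forced W o B hoB hloop, hπB B hB, hforced B]
  -- the correction sum is at least its `W' = {o}` term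
  have hmemW : ({o} : Finset (Fin n)) ∈ nullSets A := by
    rw [mem_nullSets, Finset.disjoint_singleton_left]; exact hoA
  have hcorr : μ.real (clusterIs o ({o} : Finset (Fin n))) *
        A.inf' hA (fun a => μ.real (openConnIn ((↑({o} : Finset (Fin n)) : Set (Fin n))ᶜ) a b)) ≤
      ∑ W' ∈ nullSets A, μ.real (clusterIs o W') *
        A.inf' hA (fun a => μ.real (openConnIn ((↑W' : Set (Fin n))ᶜ) a b)) := by
    refine Finset.single_le_sum (f := fun W' => μ.real (clusterIs o W') *
        A.inf' hA (fun a => μ.real (openConnIn ((↑W' : Set (Fin n))ᶜ) a b))) (fun W' _ => ?_) hmemW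
    exact mul_nonneg measureReal_nonneg ((Finset.le_inf'_iff hA _).2 fun a _ => measureReal_nonneg)
  have hcl : μ.real (clusterIs o ({o} : Finset (Fin n))) = π ∅ := by
    rw [← starEvent_empty_eq_clusterIs, ← Finset.coe_empty, hπB ∅ (Finset.empty_mem_powerset P)]
  have hinf : A.inf' hA (fun a => μ.real (openConnIn ((↑({o} : Finset (Fin n)) : Set (Fin n))ᶜ) a b)) =
      A.inf' hA (fun a => (prodBernoulli K).real (openConn a b)) := by
    refine Finset.inf'_congr hA rfl fun a ha => ?_
    have hao : a ≠ o := fun h => hoA (h ▸ ha)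
    rw [Finset.coe_singleton]
    have h1 : μ.real (openConnIn ({o}ᶜ : Set (Fin n)) a b) = (prodBernoulli K).real (openConnIn ({o}ᶜ : Set (Fin n)) a b) := by
      rw [hμ]
      refine prodBernoulli_real_eq_of_determinedBy W K (F := ({o}ᶜ : Set (Fin n)).sym2) (fun e he => ?_)
        (DCT16.determinedBy_openConnIn _ a b subset_rfl) MeasurableSet.of_discrete
      rw [hK]
      have hoe : o ∉ e := by
        induction e using Sym2.ind with
        | h x y =>
          rw [Set.mk_mem_sym2_iff] at he
          intro hmem
          rcases Sym2.mem_iff.1 hmem with rfl | rfl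
          · exact he.1 (Set.mem_singleton _)
          · exact he.2 (Set.mem_singleton _)
      simp [hoe]
    rw [h1, real_openConnIn_compl_singleton_of_isolated K o a b hao hisoK]
  have hD : π ∅ * A.inf' hA (fun a => (prodBernoulli K).real (openConn a b)) ≤
      ∑ W' ∈ nullSets A, μ.real (clusterIs o W') *
        A.inf' hA (fun a => μ.real (openConnIn ((↑W' : Set (Fin n))ᶜ) a b)) := by
    rw [← hcl, ← hinf]; exact hcorr
  -- the empty forced star is the core
  have hF0 : (fun f : Sym2 (Fin n) => if f ∈ (∅ : Finset (Fin n)).image (fun t => s(o, t)) then (1 : unitInterval) else K f) = K := by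
    funext f; simp
  have hob0 : (prodBernoulli K).real (openConn o b) = 0 := real_openConn_isolated_eq_zero K o hisoK b hbo
  -- termwise bookkeeping
  have hsum : ∀ B ∈ P.powerset, π B *
      (if B = ∅ then A.inf' hA (fun a => (prodBernoulli K).real (openConn a b)) - (prodBernoulli K).real (openConn j b)
        else (prodBernoulli (fun f : Sym2 (Fin n) => if f ∈ B.image (fun t => s(o, t)) then 1 else K f)).real (openConn o b) -
          (prodBernoulli (fun f : Sym2 (Fin n) => if f ∈ B.image (fun t => s(o, t)) then 1 else K f)).real (openConn j b)) =
      (μ.real (openConn o b ∩ starEvent o ↑B) - μ.real (openConn j b ∩ starEvent o ↑B)) +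
        (if B = ∅ then π B * A.inf' hA (fun a => (prodBernoulli K).real (openConn a b)) else 0) := by
    intro B hB
    rw [hterm o B hB, hterm j B hB]
    by_cases hBe : B = ∅
    · subst hBe
      rw [if_pos rfl, if_pos rfl, hF0, hob0]; ring
    · rw [if_neg hBe, if_neg hBe]; ring
  have hLHS : ∑ B ∈ P.powerset, ((∏ p ∈ B, (W s(o, p) : ℝ)) * ∏ u ∈ P \ B, (1 - (W s(o, u) : ℝ))) *
      (if B = ∅ then A.inf' hA (fun a => (prodBernoulli K).real (openConn a b)) - (prodBernoulli K).real (openConn j b)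
        else (prodBernoulli (fun f : Sym2 (Fin n) => if f ∈ B.image (fun t => s(o, t)) then 1 else K f)).real (openConn o b) -
          (prodBernoulli (fun f : Sym2 (Fin n) => if f ∈ B.image (fun t => s(o, t)) then 1 else K f)).real (openConn j b)) =
      (μ.real (openConn o b) - μ.real (openConn j b)) + π ∅ * A.inf' hA (fun a => (prodBernoulli K).real (openConn a b)) := by
    have h1 : ∑ B ∈ P.powerset, ((∏ p ∈ B, (W s(o, p) : ℝ)) * ∏ u ∈ P \ B, (1 - (W s(o, u) : ℝ))) *
        (if B = ∅ then A.inf' hA (fun a => (prodBernoulli K).real (openConn a b)) - (prodBernoulli K).real (openConn j b)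
          else (prodBernoulli (fun f : Sym2 (Fin n) => if f ∈ B.image (fun t => s(o, t)) then 1 else K f)).real (openConn o b) -
            (prodBernoulli (fun f : Sym2 (Fin n) => if f ∈ B.image (fun t => s(o, t)) then 1 else K f)).real (openConn j b)) =
        ∑ B ∈ P.powerset, ((μ.real (openConn o b ∩ starEvent o ↑B) - μ.real (openConn j b ∩ starEvent o ↑B)) +
          (if B = ∅ then π B * A.inf' hA (fun a => (prodBernoulli K).real (openConn a b)) else 0)) := by
      refine Finset.sum_congr rfl fun B hB => ?_
      rw [← hπ B]; exact hsum B hB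
    rw [h1, Finset.sum_add_distrib, Finset.sum_sub_distrib, ← hdec0, ← hdec1, Finset.sum_ite_eq' P.powerset ∅,
      if_pos (Finset.empty_mem_powerset P)]
  rw [hLHS]
  linarith [hD]

/-- **The formal×formal corner of the `2+2` torus at GOODNESS strength**, in forced-star coordinates.  See the module docstring.
[cite: KozmaNitzan2024, Lemma 4 (p. 7, eq. (9)), Lemma 5 (p. 13), §3.2 (p. 12)] -/
theorem gcffCorner (K : Sym2 (Fin n) → unitInterval) (o p₁ p₂ q₁ q₂ j r b : Fin n) (u v : unitInterval)
    (hp : p₁ ≠ p₂) (hq : q₁ ≠ q₂) (h11 : p₁ ≠ q₁) (h12 : p₁ ≠ q₂) (h21 : p₂ ≠ q₁)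
    (hop₁ : o ≠ p₁) (hop₂ : o ≠ p₂) (hoq₁ : o ≠ q₁) (hoq₂ : o ≠ q₂) (hjo : j ≠ o) (hbo : b ≠ o)
    (hisoK : ∀ u' : Fin n, u' ≠ o → K s(o, u') = 0)
    (G : Finset (Fin n) → ℝ)
    (hG : ∀ T : Finset (Fin n), G T =
      (prodBernoulli (fun f : Sym2 (Fin n) => if f ∈ T.image (fun t => s(o, t)) then 1 else K f)).real (openConn o b) -
        (prodBernoulli (fun f : Sym2 (Fin n) => if f ∈ T.image (fun t => s(o, t)) then 1 else K f)).real (openConn j b))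
    (hrP : (prodBernoulli K).real (openConn r b) ≤ (prodBernoulli K).real (openConn p₁ b))
    (hrQ : (prodBernoulli K).real (openConn r b) ≤ (prodBernoulli K).real (openConn q₁ b))
    (hrow : ∀ z ∈ ({r, p₁, q₁} : Finset (Fin n)), 0 ≤
      (1 - (u : ℝ)) * (1 - (v : ℝ)) * ((prodBernoulli K).real (openConn z b) - (prodBernoulli K).real (openConn j b)) +
      (u : ℝ) * (1 - (v : ℝ)) * ((prodBernoulli (fun f : Sym2 (Fin n) => if f = s(p₁, p₂) then 1 else K f)).real (openConn z b) -
        (prodBernoulli (fun f : Sym2 (Fin n) => if f = s(p₁, p₂) then 1 else K f)).real (openConn j b)) +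
      (1 - (u : ℝ)) * (v : ℝ) * ((prodBernoulli (fun f : Sym2 (Fin n) => if f = s(q₁, q₂) then 1 else K f)).real (openConn z b) -
        (prodBernoulli (fun f : Sym2 (Fin n) => if f = s(q₁, q₂) then 1 else K f)).real (openConn j b)) +
      (u : ℝ) * (v : ℝ) * ((prodBernoulli (fun f : Sym2 (Fin n) => if f = s(p₁, p₂) then 1 else if f = s(q₁, q₂) then 1 else K f)).real (openConn z b) -
        (prodBernoulli (fun f : Sym2 (Fin n) => if f = s(p₁, p₂) then 1 else if f = s(q₁, q₂) then 1 else K f)).real (openConn j b))) :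
    0 ≤ (1 - (u : ℝ)) * (1 - (v : ℝ)) * ((prodBernoulli K).real (openConn r b) - (prodBernoulli K).real (openConn j b)) +
      (u : ℝ) * (1 - (v : ℝ)) * G {p₁, p₂} + (1 - (u : ℝ)) * (v : ℝ) * G {q₁, q₂} + (u : ℝ) * (v : ℝ) * G {q₂, q₁, p₁, p₂} := by
  set eP : Sym2 (Fin n) := s(p₁, p₂) with heP
  set eQ : Sym2 (Fin n) := s(q₁, q₂) with heQ
  set eM : Sym2 (Fin n) := s(q₁, p₁) with heM
  have hPQne : eP ≠ eQ := by
    rw [heP, heQ]; intro h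
    rcases Sym2.eq_iff.1 h with ⟨h1, _⟩ | ⟨h1, _⟩
    · exact h11 h1
    · exact h12 h1
  have heMQ : eM ≠ eQ := by
    rw [heM, heQ]; intro h
    rcases Sym2.eq_iff.1 h with ⟨_, h2⟩ | ⟨h1, _⟩
    · exact h12 h2
    · exact hq h1
  have heMP : eM ≠ eP := by
    rw [heM, heP]; intro h
    rcases Sym2.eq_iff.1 h with ⟨h1, _⟩ | ⟨h1, _⟩
    · exact h11 h1.symm
    · exact h21 h1.symm
  set KP : Sym2 (Fin n) → unitInterval := fun f => if f = eP then 1 else K f with hKP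
  set KQ : Sym2 (Fin n) → unitInterval := fun f => if f = eQ then 1 else K f with hKQ
  set KPQ : Sym2 (Fin n) → unitInterval := fun f => if f = eP then 1 else if f = eQ then 1 else K f with hKPQ
  set wM : Sym2 (Fin n) → unitInterval := fun f => if f = eM then 1 else KPQ f with hwM
  -- (1) the two-formal-units inequality at goodness strength
  have key := twoFormalUnits_gc K p₁ p₂ q₁ q₂ j r b hp hq h11 hPQne u.2.1 u.2.2 v.2.1 v.2.2 hrP hrQ hrow
  -- (2) forced-star evaluations
  have hG1 : G {p₁, p₂} = (prodBernoulli KP).real (openConn p₁ b) - (prodBernoulli KP).real (openConn j b) := by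
    have h := forcedMargin_eq K o b j hisoK hbo hjo {p₁, p₂} (by simp [hop₁, hop₂]) p₁ (by simp) {eP}
      (by intro e he x hx; rw [Finset.mem_singleton] at he; subst he; rw [heP] at hx
          rcases Sym2.mem_iff.1 hx with rfl | rfl <;> simp)
      (by intro t ht; simp only [Finset.mem_insert, Finset.mem_singleton] at ht
          rcases ht with rfl | rfl
          · exact Or.inl rfl
          · exact Or.inr (Or.inl (by rw [heP]; simp)))
    rw [hG, h]; simp [hKP]
  have hG2 : G {q₁, q₂} = (prodBernoulli KQ).real (openConn q₁ b) - (prodBernoulli KQ).real (openConn j b) := by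
    have h := forcedMargin_eq K o b j hisoK hbo hjo {q₁, q₂} (by simp [hoq₁, hoq₂]) q₁ (by simp) {eQ}
      (by intro e he x hx; rw [Finset.mem_singleton] at he; subst he; rw [heQ] at hx
          rcases Sym2.mem_iff.1 hx with rfl | rfl <;> simp)
      (by intro t ht; simp only [Finset.mem_insert, Finset.mem_singleton] at ht
          rcases ht with rfl | rfl
          · exact Or.inl rfl
          · exact Or.inr (Or.inl (by rw [heQ]; simp)))
    rw [hG, h]; simp [hKQ]
  have hG4 : G {q₂, q₁, p₁, p₂} = (prodBernoulli wM).real (openConn p₁ b) - (prodBernoulli wM).real (openConn j b) := by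
    have h := forcedMargin_eq K o b j hisoK hbo hjo {q₂, q₁, p₁, p₂} (by simp [hoq₁, hoq₂, hop₁, hop₂]) p₁ (by simp) {eM, eP, eQ}
      (by intro e he x hx; simp only [Finset.mem_insert, Finset.mem_singleton] at he
          rcases he with rfl | rfl | rfl
          · rw [heM] at hx; rcases Sym2.mem_iff.1 hx with rfl | rfl <;> simp
          · rw [heP] at hx; rcases Sym2.mem_iff.1 hx with rfl | rfl <;> simp
          · rw [heQ] at hx; rcases Sym2.mem_iff.1 hx with rfl | rfl <;> simp)
      (by intro t ht; simp only [Finset.mem_insert, Finset.mem_singleton] at ht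
          rcases ht with rfl | rfl | rfl | rfl
          · exact Or.inr (Or.inr ⟨q₁, h11.symm, hq, by rw [heM]; simp, by rw [heQ]; simp⟩)
          · exact Or.inr (Or.inl (by rw [heM, Sym2.eq_swap]; simp))
          · exact Or.inl rfl
          · exact Or.inr (Or.inl (by rw [heP]; simp)))
    have hwM' : (fun f : Sym2 (Fin n) => if f ∈ ({eM, eP, eQ} : Finset (Sym2 (Fin n))) then (1 : unitInterval) else K f) = wM := by
      funext f
      simp only [hwM, hKPQ, Finset.mem_insert, Finset.mem_singleton]
      by_cases h1 : f = eM
      · simp [h1]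
      · by_cases h2 : f = eP
        · simp [h2, heMP.symm]
        · by_cases h3 : f = eQ
          · simp [h3, heMQ.symm, hPQne.symm]
          · simp [h1, h2, h3]
    rw [hG, h, hwM']
  rw [hG1, hG2, hG4]
  exact key

end KNGoodTwoTwo

end

end Summit.CriticalPhenomena.PercolationContinuityZ3.Theorems
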